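import Literature.NumberTheory.EllipticCurves.BSDLowerBoundLayersProofs

/-!
# In analytic rank one, "`ord_{s=1} L = 1 ⟹ ord_{T=0} L_p = 1`" is Schneider's conjecture — per prime, and for one prime of our choosing

Write `a = ord_{s=1} L(E,s)`, `r = rank E(ℚ)`, `ρ_p = ord_{T=0} L_p(E,T)`
(`(padicLFunction f (unitRoot W p)).order` for the newform `f` of `E`, on a globally minimal model,
at a good ordinary `p`).  The `p`-adic half of the rank conjecture in two-wall form asks for ONE odd
good ordinary prime with `ρ_p ≤ a` (`forall_analyticRank_eq_rank_of_orderTransfer_of_lowerBound`);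
letting `p` range over all suitable primes gives nothing new, since
"`∀ k, (∀ p, ρ_p ≥ k) ⟹ a ≥ k`" is literally "`∃ p, ρ_p ≤ a`".  This file calibrates the first
non-trivial layer of that transfer in the one rank where everything else is known:

* `order_eq_order_of_iwasawaToPowerSeries_eq` / `order_padicLFunction_eq_order_charGenerator` —
  under the main conjecture at `p` (`char X(E/ℚ_∞) = (g)`, `ι g = p^k L_p(E,T)` for the coefficientwise
  embedding `ι : ℤ_p⟦T⟧ ↪ ℚ_p⟦T⟧`), `ρ_p = ord_T g`;
* `order_padicLFunction_le_one_of_analyticRank_eq_one_iff_schneider` (per curve, per suitable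
  prime `p ≥ 5`, good ordinary, `E[p]` irreducible) — over Gross–Zagier–Kolyvagin, the main conjecture,
  Perrin-Riou–Schneider (`Schneider1985_order_charGenerator`) and the rank-one `p`-converses of Kim and
  Burungale–Tian:  `(a = 1 → ρ_p ≤ 1) ↔ (r = 1 → Ш(E) finite → the canonical cyclotomic p-adic height
  is non-degenerate)`, i.e. **the degree-one "complex ⟹ `p`-adic" order transfer at `p` is exactly
  Schneider's conjecture at `p` for rank-one curves with finite `Ш`**;
* `forall_exists_order_padicLFunction_le_one_iff_forall_exists_schneider` — hence the `∃ p` form the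
  two-wall census actually uses: "every globally minimal `E/ℚ` with `a = 1` has SOME suitable prime with
  `ρ_p ≤ 1`" is equivalent to "every globally minimal `E/ℚ` with `r = 1` and `Ш(E)` finite has SOME
  suitable prime at which the canonical `p`-adic height is non-degenerate" — Schneider's conjecture at a
  single prime of our choosing, proved for CM curves only (Bertrand 1982) as far as the sources below say.

So the degree-`2` layer "`(∀ p, ρ_p ≥ 2) ⟹ a ≥ 2`" of the all-prime transfer, which the rank
conjecture does NOT need (`r ≥ 3 ⟹ a ≥ 2` is Gross–Zagier–Kolyvagin), is already an open
transcendence-type statement; the layers it does need (`k ≥ 3`, `r ≥ 3`) lie above it.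

References: P. Schneider, Invent. Math. 79 (1985); B. Perrin-Riou, Invent. Math. 89 (1987);
D. Bertrand, *Valeurs de fonctions thêta et hauteurs p-adiques*, Sém. Théorie des Nombres Paris
1980–81, Progr. Math. 22 (1982); W. Stein, C. Wuthrich, *Algorithms for the arithmetic of elliptic
curves using Iwasawa theory*, Math. Comp. 82 (2013), §4.1, Conj. 4.1 and the remark following it
("Apart from the special case treated in [Ber82] … there are hardly any results on this conjecture"); J. Balakrishnan, J. S. Müller, W. Stein,
Math. Comp. 85 (2016), Thm. 1.7; A. Burungale, F. Castella, C. Skinner, arXiv:2405.00270, Thm. 1.1.2 (a);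
C.-H. Kim, Math. Ann. 387 (2022), Cor. 1.4; A. Burungale, Y. Tian, Invent. Math. 220 (2020).
-/

open scoped Classical MatrixGroups ModularForm
open CongruenceSubgroup WeierstrassCurve Literature.NumberTheory.EllipticCurves.ModularForms

namespace Literature.NumberTheory.EllipticCurves

/-! ### Orders under `ι : ℤ_p⟦T⟧ ↪ ℚ_p⟦T⟧` and under the main conjecture -/

/-- **`ρ_p = ord_T g` under the main conjecture.** If `ι g = p^k · L` in `ℚ_p⟦T⟧` (`k ∈ ℤ`) then
`ord_T L = ord_T g`: the coefficientwise embedding `ι : ℤ_p⟦T⟧ ↪ ℚ_p⟦T⟧` preserves the order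
(`ord_T ι(g) = ord_T g`, injectivity on coefficients) and `p^k` is a unit of `ℚ_p⟦T⟧`.  (With `g` a
generator of `char X(E/ℚ_∞)` and `L = L_p(E,T)` this is the order-of-vanishing content of Mazur's
main conjecture in `Λ ⊗ ℚ_p`.) [cite: MazurTateTeitelbaum1986, §I.12]
[cite: BurungaleCastellaSkinner2025, Thm. 1.1.2 (a)] -/
theorem order_eq_order_of_iwasawaToPowerSeries_eq (p : ℕ) [Fact p.Prime] {g : IwasawaAlgebra p}
    {k : ℤ} {L : PowerSeries ℚ_[p]}
    (hιg : iwasawaToPowerSeries p g = PowerSeries.C ((p : ℚ_[p]) ^ k) * L) :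
    L.order = g.order := by
  -- `ord_T ι(g) = ord_T g`
  have hι : (iwasawaToPowerSeries p g).order = g.order := by
    refine le_antisymm ?_ (PowerSeries.le_order_map _)
    refine PowerSeries.le_order _ _ fun i hi => ?_
    have h := PowerSeries.coeff_of_lt_order i hi
    have hinj : Function.Injective (algebraMap ℤ_[p] ℚ_[p]) := Subtype.coe_injective
    rw [PowerSeries.coeff_map] at h
    exact hinj (h.trans (map_zero (algebraMap ℤ_[p] ℚ_[p])).symm)
  -- `ord_T (p^k · L) = ord_T L`
  have hp0 : (p : ℚ_[p]) ≠ 0 := by exact_mod_cast (Fact.out : p.Prime).ne_zero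
  have hpk : IsUnit (PowerSeries.C ((p : ℚ_[p]) ^ k)) :=
    IsUnit.map PowerSeries.C (IsUnit.mk0 _ (zpow_ne_zero k hp0))
  rw [← hι, hιg, PowerSeries.order_mul, PowerSeries.order_zero_of_unit hpk, zero_add]

/-! ### Per curve and per prime -/

section PerPrime

variable (W : WeierstrassCurve ℚ) [W.IsElliptic] [W.IsGloballyMinimal] (p : ℕ) [Fact p.Prime]

/-- **`ρ_p = ord_T g` for the generator of the main conjecture, at the newform of `E`.** At a good
ordinary `p ≥ 5` with `E[p]` irreducible, granting the main conjecture (`hMC`): for the cyclotomic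
data `(κ, γ)`, any Pontryagin-dual datum `D` and any newform `f` of `E`, the generator `g` it provides
satisfies `ord_{T=0} L_p(E,T) = ord_T g`. [cite: BurungaleCastellaSkinner2025, Thm. 1.1.2 (a)] -/
theorem order_padicLFunction_eq_order_charGenerator
    (hMC : burungale_castella_skinner_charIdeal_eq_padicLFunction)
    (hp : 5 ≤ p) (hgood : W.HasGoodReductionAtPrime p) (hord : ¬ (p : ℤ) ∣ W.frobeniusTrace p)
    (hirr : W.HasIrreducibleModPGaloisRep p)
    {κ : ZpExtension ℚ p} {γ : Field.absoluteGaloisGroup ℚ}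
    (hκ : κ.IsCyclotomic) (hγ : κ.IsTopGenerator γ) (hγ' : IsCyclotomicVariable p γ)
    {N : ℕ} [NeZero N] {f : CuspForm (Gamma0 N) 2} (hf : IsNewformOf W f)
    (D : W.SelmerDualData κ γ) :
    ∃ g : IwasawaAlgebra p, D.IsTorsion ∧ D.charIdeal = Ideal.span {g} ∧
      (padicLFunction f (unitRoot W p : ℚ_[p])).order = g.order := by
  obtain ⟨hX, g, k, hchar, hιg⟩ := hMC W p κ γ f hp hgood hord hirr hκ hγ hγ' hf D
  exact ⟨g, hX, hchar, order_eq_order_of_iwasawaToPowerSeries_eq p hιg⟩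

/-- **Per curve and per prime: the degree-one "complex ⟹ `p`-adic" transfer is Schneider's
conjecture.** Let `W` be a global minimal model of `E/ℚ`, `p ≥ 5` good ordinary with `E[p]`
irreducible.  Over Gross–Zagier–Kolyvagin (`hGZK`), the main conjecture (`hMC`),
Perrin-Riou–Schneider (`hS`) and the rank-one `p`-converses (`hKim`, `hBT`):
`(ord_{s=1} L(E,s) = 1 → ord_{T=0} L_p(E,T) ≤ 1 for every newform f of E) ↔
 (rank E(ℚ) = 1 → Ш(E) finite → the canonical cyclotomic p-adic height on E is non-degenerate)`.
(`←`: `a = 1` gives `r = 1`, `Ш` finite (GZK), so Schneider at `p` gives `ord_T f_E = r = 1`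
(Perrin-Riou–Schneider) and `ρ_p = ord_T f_E` (main conjecture).  `→`: `r = 1`, `Ш` finite give
`a = 1` (`p`-converse), so `ρ_p ≤ 1`; with `r ≤ ord_T f_E = ρ_p` this is `ord_T f_E = r`, i.e.
Schneider at `p`.) [cite: BalakrishnanMullerStein2015, Thm. 1.7]
[cite: BurungaleCastellaSkinner2025, Thm. 1.1.2 (a)] [cite: Kim2022, Cor. 1.4] [cite: Darmon2004, Thm. 3.22] -/
theorem order_padicLFunction_le_one_of_analyticRank_eq_one_iff_schneider
    (hGZK : rank_eq_analyticRank_of_analyticRank_le_one)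
    (hKim : kim_analyticRank_eq_one_of_mordellWeilRank_eq_one)
    (hBT : burungaleTian_analyticRank_eq_one_of_selmerCorank_eq_one_of_hasCM)
    (hmod : exists_isNewformOf) (hMC : burungale_castella_skinner_charIdeal_eq_padicLFunction)
    (hS : Schneider1985_order_charGenerator)
    (hp : 5 ≤ p) (hgood : W.HasGoodReductionAtPrime p) (hord : ¬ (p : ℤ) ∣ W.frobeniusTrace p)
    (hirr : W.HasIrreducibleModPGaloisRep p) :
    (W.analyticRank = 1 → ∀ {N : ℕ} [NeZero N] (f : CuspForm (Gamma0 N) 2), IsNewformOf W f →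
        (padicLFunction f (unitRoot W p : ℚ_[p])).order ≤ 1) ↔
      (W.mordellWeilRank = 1 → Finite W.sha →
        ∀ Dh : PAdicHeightData W p, Dh.IsCanonical → SchneiderConjecture Dh) := by
  -- the cyclotomic setting and the Iwasawa module (tree theorems)
  obtain ⟨κ, hκ, γ, hγ, hγ'⟩ := exists_isCyclotomic_isTopGenerator_isCyclotomicVariable_holds p
  obtain ⟨D⟩ := W.nonempty_selmerDualData_holds κ γ hγ
  haveI : Module.Finite (IwasawaAlgebra p) D.X := D.module_finite_holds hγ
  -- the newform of `E` (modularity)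
  haveI : NeZero (W.conductorNorm ℤ) := ⟨(W.conductorNorm_pos_holds).ne'⟩
  obtain ⟨f₀, hf₀⟩ := hmod W
  constructor
  · intro h hr hsha Dh hDh
    have ha : W.analyticRank = 1 :=
      analyticRank_eq_one_of_mordellWeilRank_eq_one_of_finite_sha hKim hBT W hr hsha
    have hρ := h ha f₀ hf₀
    obtain ⟨g, hX, hchar, hρg⟩ :=
      order_padicLFunction_eq_order_charGenerator W p hMC hp hgood hord hirr hκ hγ hγ' hf₀ D
    have hle : (W.mordellWeilRank : ℕ∞) ≤ g.order :=
      hS.mordellWeilRank_le_order hp hgood hord hκ hγ hγ' D hX hchar hDh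
    have heq : g.order = W.mordellWeilRank := by
      apply le_antisymm _ hle
      rw [hr, ← hρg]
      exact_mod_cast hρ
    exact ((hS.order_eq_iff hp hgood hord hκ hγ hγ' D hX hchar hDh).1 heq).1
  · intro h ha N _ f hf
    have hr : W.mordellWeilRank = 1 := by
      have h1 := (hGZK W (le_of_eq ha)).1
      rw [h1, ha]
    haveI : Finite W.sha := (hGZK W (le_of_eq ha)).2
    obtain ⟨Dh, hDh, -⟩ := existsUnique_isCanonical_holds W p hp hgood hord
    have hSch : SchneiderConjecture Dh := h hr inferInstance Dh hDh
    obtain ⟨g, hX, hchar, hρg⟩ :=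
      order_padicLFunction_eq_order_charGenerator W p hMC hp hgood hord hirr hκ hγ hγ' hf D
    have hfin : Finite (AddCommGroup.primaryComponent W.sha p) := inferInstance
    have heq : g.order = W.mordellWeilRank :=
      (hS.order_eq_iff hp hgood hord hκ hγ hγ' D hX hchar hDh).2 ⟨hSch, hfin⟩
    rw [hρg, heq, hr]
    exact_mod_cast le_rfl

/-- **The same, with equality.** Under the same facts, at a suitable prime:
`(a = 1 → ρ_p = 1 for every newform) ↔ (r = 1 → Ш finite → Schneider at p)` — since `a = 1` forces
`ρ_p ≥ 1` anyway (`r = 1 ≤ ord_T f_E = ρ_p`). [cite: BalakrishnanMullerStein2015, Thm. 1.7]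
[cite: BurungaleCastellaSkinner2025, Thm. 1.1.2 (a)] -/
theorem order_padicLFunction_eq_one_of_analyticRank_eq_one_iff_schneider
    (hGZK : rank_eq_analyticRank_of_analyticRank_le_one)
    (hKim : kim_analyticRank_eq_one_of_mordellWeilRank_eq_one)
    (hBT : burungaleTian_analyticRank_eq_one_of_selmerCorank_eq_one_of_hasCM)
    (hmod : exists_isNewformOf) (hMC : burungale_castella_skinner_charIdeal_eq_padicLFunction)
    (hS : Schneider1985_order_charGenerator)
    (hp : 5 ≤ p) (hgood : W.HasGoodReductionAtPrime p) (hord : ¬ (p : ℤ) ∣ W.frobeniusTrace p)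
    (hirr : W.HasIrreducibleModPGaloisRep p) :
    (W.analyticRank = 1 → ∀ {N : ℕ} [NeZero N] (f : CuspForm (Gamma0 N) 2), IsNewformOf W f →
        (padicLFunction f (unitRoot W p : ℚ_[p])).order = 1) ↔
      (W.mordellWeilRank = 1 → Finite W.sha →
        ∀ Dh : PAdicHeightData W p, Dh.IsCanonical → SchneiderConjecture Dh) := by
  rw [← order_padicLFunction_le_one_of_analyticRank_eq_one_iff_schneider W p hGZK hKim hBT hmod hMC
    hS hp hgood hord hirr]
  constructor
  · intro h ha N _ f hf
    exact le_of_eq (h ha f hf)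
  · intro h ha N _ f hf
    apply le_antisymm (h ha f hf)
    -- `1 = r ≤ ord_T g = ρ_p`
    obtain ⟨κ, hκ, γ, hγ, hγ'⟩ := exists_isCyclotomic_isTopGenerator_isCyclotomicVariable_holds p
    obtain ⟨D⟩ := W.nonempty_selmerDualData_holds κ γ hγ
    haveI : Module.Finite (IwasawaAlgebra p) D.X := D.module_finite_holds hγ
    obtain ⟨Dh, hDh, -⟩ := existsUnique_isCanonical_holds W p hp hgood hord
    obtain ⟨g, hX, hchar, hρg⟩ :=
      order_padicLFunction_eq_order_charGenerator W p hMC hp hgood hord hirr hκ hγ hγ' hf D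
    have hr : W.mordellWeilRank = 1 := by
      have h1 := (hGZK W (le_of_eq ha)).1
      rw [h1, ha]
    have hle : (W.mordellWeilRank : ℕ∞) ≤ g.order :=
      hS.mordellWeilRank_le_order hp hgood hord hκ hγ hγ' D hX hchar hDh
    rw [hρg]
    rw [hr] at hle
    exact_mod_cast hle

end PerPrime

/-! ### Universal forms: all primes, and one prime of our choosing -/

section Universal

/-- **All suitable primes.** Over the same facts:
`(∀ E globally minimal, ∀ suitable p, a = 1 → ρ_p ≤ 1) ↔
 (∀ E globally minimal, ∀ suitable p, r = 1 → Ш finite → Schneider at p)` — the degree-one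
"complex ⟹ `p`-adic" transfer at every prime is Schneider's conjecture in rank one at every prime.
[cite: BalakrishnanMullerStein2015, Thm. 1.7] [cite: BurungaleCastellaSkinner2025, Thm. 1.1.2 (a)] -/
theorem forall_order_padicLFunction_le_one_iff_forall_schneider
    (hGZK : rank_eq_analyticRank_of_analyticRank_le_one)
    (hKim : kim_analyticRank_eq_one_of_mordellWeilRank_eq_one)
    (hBT : burungaleTian_analyticRank_eq_one_of_selmerCorank_eq_one_of_hasCM)
    (hmod : exists_isNewformOf) (hMC : burungale_castella_skinner_charIdeal_eq_padicLFunction)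
    (hS : Schneider1985_order_charGenerator) :
    (∀ (W : WeierstrassCurve ℚ) [W.IsElliptic] [W.IsGloballyMinimal] (p : ℕ) [Fact p.Prime],
        5 ≤ p → W.HasGoodReductionAtPrime p → ¬ (p : ℤ) ∣ W.frobeniusTrace p →
        W.HasIrreducibleModPGaloisRep p → W.analyticRank = 1 →
        ∀ {N : ℕ} [NeZero N] (f : CuspForm (Gamma0 N) 2), IsNewformOf W f →
          (padicLFunction f (unitRoot W p : ℚ_[p])).order ≤ 1) ↔
      (∀ (W : WeierstrassCurve ℚ) [W.IsElliptic] [W.IsGloballyMinimal] (p : ℕ) [Fact p.Prime],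
        5 ≤ p → W.HasGoodReductionAtPrime p → ¬ (p : ℤ) ∣ W.frobeniusTrace p →
        W.HasIrreducibleModPGaloisRep p → W.mordellWeilRank = 1 → Finite W.sha →
        ∀ Dh : PAdicHeightData W p, Dh.IsCanonical → SchneiderConjecture Dh) := by
  constructor
  · intro h W _ _ p _ hp hgood hord hirr
    exact (order_padicLFunction_le_one_of_analyticRank_eq_one_iff_schneider W p hGZK hKim hBT hmod
      hMC hS hp hgood hord hirr).1 (h W p hp hgood hord hirr)
  · intro h W _ _ p _ hp hgood hord hirr
    exact (order_padicLFunction_le_one_of_analyticRank_eq_one_iff_schneider W p hGZK hKim hBT hmod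
      hMC hS hp hgood hord hirr).2 (h W p hp hgood hord hirr)

/-- **One prime of our choosing (the form the two-wall census uses).** Over the same facts:
"every globally minimal `E/ℚ` with `ord_{s=1} L(E,s) = 1` has SOME good ordinary `p ≥ 5` with `E[p]`
irreducible and `ord_{T=0} L_p(E,T) ≤ 1`" is equivalent to "every globally minimal `E/ℚ` of rank `1`
with `Ш(E)` finite has SOME such prime at which the canonical cyclotomic `p`-adic height is
non-degenerate" — Schneider's conjecture at a single prime, proved for CM curves (Bertrand) only, as
far as the cited sources say.  The rank conjecture itself does not need this layer.
[cite: BalakrishnanMullerStein2015, Thm. 1.7] [cite: BurungaleCastellaSkinner2025, Thm. 1.1.2 (a)]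
[cite: Kim2022, Cor. 1.4] [cite: Darmon2004, Thm. 3.22] -/
theorem forall_exists_order_padicLFunction_le_one_iff_forall_exists_schneider
    (hGZK : rank_eq_analyticRank_of_analyticRank_le_one)
    (hKim : kim_analyticRank_eq_one_of_mordellWeilRank_eq_one)
    (hBT : burungaleTian_analyticRank_eq_one_of_selmerCorank_eq_one_of_hasCM)
    (hmod : exists_isNewformOf) (hMC : burungale_castella_skinner_charIdeal_eq_padicLFunction)
    (hS : Schneider1985_order_charGenerator) :
    (∀ (W : WeierstrassCurve ℚ) [W.IsElliptic] [W.IsGloballyMinimal], W.analyticRank = 1 →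
        ∃ (p : ℕ) (_ : Fact p.Prime), 5 ≤ p ∧ W.HasGoodReductionAtPrime p ∧
          ¬ (p : ℤ) ∣ W.frobeniusTrace p ∧ W.HasIrreducibleModPGaloisRep p ∧
          ∀ {N : ℕ} [NeZero N] (f : CuspForm (Gamma0 N) 2), IsNewformOf W f →
            (padicLFunction f (unitRoot W p : ℚ_[p])).order ≤ 1) ↔
      (∀ (W : WeierstrassCurve ℚ) [W.IsElliptic] [W.IsGloballyMinimal], W.mordellWeilRank = 1 →
        Finite W.sha →
        ∃ (p : ℕ) (_ : Fact p.Prime), 5 ≤ p ∧ W.HasGoodReductionAtPrime p ∧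
          ¬ (p : ℤ) ∣ W.frobeniusTrace p ∧ W.HasIrreducibleModPGaloisRep p ∧
          ∀ Dh : PAdicHeightData W p, Dh.IsCanonical → SchneiderConjecture Dh) := by
  constructor
  · intro h W _ _ hr hsha
    have ha : W.analyticRank = 1 :=
      analyticRank_eq_one_of_mordellWeilRank_eq_one_of_finite_sha hKim hBT W hr hsha
    obtain ⟨p, hP, hp, hgood, hord, hirr, hρ⟩ := h W ha
    refine ⟨p, hP, hp, hgood, hord, hirr, ?_⟩
    exact (order_padicLFunction_le_one_of_analyticRank_eq_one_iff_schneider W p hGZK hKim hBT hmod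
      hMC hS hp hgood hord hirr).1 (fun _ => hρ) hr hsha
  · intro h W _ _ ha
    have hr : W.mordellWeilRank = 1 := by
      have h1 := (hGZK W (le_of_eq ha)).1
      rw [h1, ha]
    haveI : Finite W.sha := (hGZK W (le_of_eq ha)).2
    obtain ⟨p, hP, hp, hgood, hord, hirr, hSch⟩ := h W hr inferInstance
    refine ⟨p, hP, hp, hgood, hord, hirr, ?_⟩
    exact (order_padicLFunction_le_one_of_analyticRank_eq_one_iff_schneider W p hGZK hKim hBT hmod
      hMC hS hp hgood hord hirr).2 (fun _ _ => hSch) ha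

end Universal

end Literature.NumberTheory.EllipticCurves
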